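import Summits.BirchSwinnertonDyer.Rank1Residual.Additive.RamifiedSevenGenusThetaRepCoherence
import Summits.BirchSwinnertonDyer.Rank1Residual.Additive.RamifiedSevenGenusCarrierAlgebra
import Summits.BirchSwinnertonDyer.Rank1Residual.Additive.RamifiedSevenGenusNumberFieldColumnTwo
import HarnessLib

set_option autoImplicit false

/-!
# `𝒞₇` genus road (crux `EllipticUnitValueSevenOfGZK`, K7r), row K2C-16, part (K3): the SMALL INPUTS of the frame constructor
# `katoGenusFrameOf` — the layer bookkeeping `hHU`/`hVH` of `kummerNonvanishing_of_genusResidue`, the K16-gap conversion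
# «`euK 𝔞 ∉ φ_*(𝐇¹)` ⇒ `EU 𝔞 ∉ π·𝐇′(S′_W)`», the ★-placement with a member type `a ∈ ℕ`, and three arithmetic trifles

Cell bsd-cm, seat bsd-cm-prr-ty1 g36 (literature-prover); CHECK line STATUS l.4199 (K3); pen rulings D1085 (a2) («`Φ.a := memberType W`,
`zS := π^{−a}·res(zOne)/7^k`»), D1089 («produce hHU, hVH, hx, he in the currency of `kummerNonvanishing_of_genusResidue`'s binders»), D1095
(K16-gap: «`EU_not_mem_of_residue` is FILLED by `fun hres => ⟨conversion⟩ (T3a `not_mem_range_isogenyMap_of_ne_zero` (kummerNonvanishing … hres))`»).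
THEOREMS ONLY (no `def`, no named fact, no `instance`, no notation, no `sorry`); nothing here is conditional on a named fact.

WHAT IS PROVED.
* §1 `isTwist_span_seven_mul_of_isTwist` (an admissible twist of `𝔣 = (s)(d)` is one of
  `(7d)`: same radical `6·7·𝔭·(d)`); `exists_geomTorsion_lift` (an isogeny `φ : V → V` restricts to an additive endomorphism `g` of `V[n]`
  with `↑(g P) = φ ↑P` — the binder `g₁`/`hg₁` of L6).
* §2 ★ `layerFixing_le_layerSubgroup` = `hHU`: `Hₙ = Gal(K̄/e⁻¹F′ₙ) ≤ Gal(K̄/Kℚ_n)` for the cyclotomic `ℤ₇`-extension restricted to the CM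
  field — `σ ∈ Hₙ` fixes `μ_{7^{n+1}}(K̄)` (their `e`-images are `7^{n+1}`-th roots of unity, in `F′ₙ`), so `χ₇(σ) ≡ 1 (7^{n+1})`, so
  `σ ∈ Gal(K̄/Kℚ_n)` (`NumberFieldColumn.mem_layerSubgroup_restrict_of_dvd_cyclotomicCharacter_sub_one`, Washington §13.1).
* §3 ★ `galFixing_katoLayer_span_seven_mul_le_layerFixing` = the core of `hVH`: `Gal(K̄/K(7ⁿ·(7d))) ≤ Hₙ` (`e⁻¹F′ₙ ⊆ K(7ⁿ(7d))`,
  p817965's `preimageField_layer_le_katoLayer_span_seven_mul`); at the frame `V n = Gal(K̄/K(7ⁿ(7d)))` is F∃-2b's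
  `KummerUnitTower.V_eq_galFixing_katoLayer`.
* §4 ★ `not_exists_mem_range_eq_pi_smul_of_not_mem_range_isogenyMap` = the K16-gap conversion in the (C1) currency of the frame
  (`HS := range toRat`, `EU 𝔞 := mkLinearMap (euK 𝔞)`, `π := ϖ`): `x ∉ range φ_*` ⇒ `¬ ∃ y ∈ HS, ιS x = ϖ • y` (`mem_HS_iff`, `ιS_isogenyMap`,
  `ιS_injective`).
* §5 ★ `j_zOne_of_memberType` = THE ★-PLACEMENT WITH A MEMBER TYPE `a : ℕ` (D1085 (a2)): for `zS := (−ϖ)^a • (res zOne / 7^{k+a})`,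
  `j zOne = 7^k • (1 • π^a • zS)` (`π·(−ϖ) = 7`), and `twistedZS_eq_one_smul` (`zeta_eq` at `t := 1`) — so that `katoGenusFrameOf` sets
  `Φ.a := memberType W` WITHOUT inheriting `a := 0` from (C2).

HONEST LABEL: bookkeeping lemmas for a constructor; nothing about Kato's zeta values proved; no stub closes; stmt-BirchSwinnertonDyer-19945 OPEN;
`X12.CMRamifiedSeven` NOT proved; no summit statement is proved by this seat; BSD claimed for no curve.

## References
* K. Kato, Astérisque 295 (2004), §13.9 (p. 230), 15.14 (p. 264), (15.16.1) (p. 265), Thm. 12.4 (2) / 12.5 (1) (pp. 221–222). [Kato2004Asterisque]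
* L. C. Washington, *Introduction to Cyclotomic Fields* (1997), §13.1. [Washington1997]
* J.-P. Serre, *Abelian ℓ-adic representations* (1968), Ch. I §1.2 (the cyclotomic character). [Serre1968]
* M. F. Atiyah, I. G. Macdonald (1969), Ch. 3 (modules of fractions). [AtiyahMacdonald1969]
* J. H. Silverman, *The Arithmetic of Elliptic Curves* (2009), III §4, III.7.4. [SilvermanAEC2009]
* Tree: `RamifiedSevenGenusThetaRepCoherence.lean` (p817965), `RamifiedSevenGenusCarrierAlgebra.lean` (C1, p798180),
  `RamifiedSevenGenusStarColumn.lean` (C2, p798933), `RamifiedSevenGenusNumberFieldColumnTwo.lean`, `RamifiedSevenGenusKummerNonvanishing.lean` (L6).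
-/

noncomputable section

open scoped NumberField
open IsDedekindDomain NumberField Field
open WeierstrassCurve (geomPoints geomTorsion)
open Literature.NumberTheory.IwasawaTheory
open Literature.NumberTheory.NumberFields (rayClassField)
open Literature.NumberTheory.GaloisRepresentations Literature.NumberTheory.GaloisRepresentations.LocalWeilDatum
open Literature.NumberTheory.EllipticCurves
open Literature.NumberTheory.EllipticCurves.Kato2004
open Literature.NumberTheory.ComplexMultiplication.EllipticUnits

namespace Summit.BirchSwinnertonDyer.Rank1Residual.Additive.GenusSeven

/-! ## §1 Two trifles: `(s)(d)`-twists are `(7d)`-twists; an isogeny restricts to `V[n]` (`|D|` odd is the tree's `GenusFrame.odd_d`) -/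

section Twist

variable {K : Type} [Field K] [NumberField K]

/-- **An admissible twist of `𝔣 = (s)·(d)` is an admissible twist of `(7d)`** (`[K : ℚ] = 2`, `s² = −7`, `d ≠ 0`): the moduli `6·7·(s)(d)`
and `6·7·(7d)` have the same prime divisors (`EllipticUnitColumn.isCoprime_of_isTwist`).
[cite: Kato2004Asterisque, §15.6 (p. 254, «𝔞 prime to 6p𝔣»)] -/
theorem isTwist_span_seven_mul_of_isTwist (h2 : Module.finrank ℚ K = 2) (s : 𝓞 K) (hs : (s : K) ^ 2 = -7) {d : ℕ}
    (hd : d ≠ 0) {𝔞 : Ideal (𝓞 K)} (h𝔞 : IsTwist 7 (Ideal.span {s} * Ideal.span {((d : ℕ) : 𝓞 K)}) 𝔞) :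
    IsTwist 7 (Ideal.span {((7 * d : ℕ) : 𝓞 K)}) 𝔞 := by
  have hN : Ideal.absNorm (Ideal.span {s} * Ideal.span {((d : ℕ) : 𝓞 K)}) = 7 * d ^ 2 :=
    absNorm_span_sqrt_mul_span_natCast h2 s hs d
  have hdvd : Ideal.span {s} * Ideal.span {((d : ℕ) : 𝓞 K)} ∣ Ideal.span {((7 * d : ℕ) : 𝓞 K)} := by
    rw [Nat.cast_mul, ← Ideal.span_singleton_mul_span_singleton, Nat.cast_ofNat,
      span_seven_eq_span_sqrt_sq s (sq_eq_neg_seven_ringOfIntegers hs), sq, mul_assoc]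
    exact Dvd.intro_left _ rfl
  refine ⟨?_, h𝔞.2⟩
  have hcop := EllipticUnitColumn.isCoprime_of_isTwist h2 hd hN hdvd h𝔞
  rw [katoModulus6, Ideal.span_singleton_mul_span_singleton, ← Nat.cast_mul]
  exact hcop

end Twist

/-- **An isogeny `φ : V → V′` restricts to an additive map `V[n] → V′[n]`** lifting `φ` (`n • φ P = φ (n • P) = 0`) — the binder
`g₁`/`hg₁` of `kummerNonvanishing_of_genusResidue` for `φ = √−7` on `W_K[7]`. [cite: SilvermanAEC2009, III §4 (isogenies are homomorphisms)] -/
theorem exists_geomTorsion_lift {L : Type} [Field L] {V V' : WeierstrassCurve L} (φ : WeierstrassCurve.Isogeny V V') (n : ℤ) :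
    ∃ g : geomTorsion V n →+ geomTorsion V' n, ∀ P : geomTorsion V n, ((g P : geomTorsion V' n) : geomPoints V') = φ (P : geomPoints V) := by
  have hmem : ∀ P : geomTorsion V n, φ (P : geomPoints V) ∈ geomTorsion V' n := fun P => by
    have h0 : n • (P : geomPoints V) = 0 := (Submodule.mem_torsionBy_iff _ _).mp P.2
    have h1 : n • φ (P : geomPoints V) = 0 := by rw [← map_zsmul, h0, map_zero]
    exact (Submodule.mem_torsionBy_iff _ _).mpr h1
  exact ⟨{ toFun := fun P => ⟨φ (P : geomPoints V), hmem P⟩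
           map_zero' := Subtype.ext (by simp)
           map_add' := fun P Q => Subtype.ext (by
             change φ ((P : geomPoints V) + (Q : geomPoints V)) = φ (P : geomPoints V) + φ (Q : geomPoints V)
             exact map_add φ _ _) }, fun P => rfl⟩

/-! ## §2 `hHU`: `Hₙ ≤ Gal(K̄/Kℚ_n)` -/

section LayerGroups

variable (F : GenusFrame) {Kcm : Type} [Field Kcm] [NumberField Kcm]

/-- ★ **`hHU`: `Hₙ = Gal(K̄/e⁻¹F′ₙ) ≤ Gal(K̄/Kℚ_n)`** for the cyclotomic `ℤ₇`-extension `K` of `ℚ` restricted to the CM field (the binder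
`hHU` of `kummerNonvanishing_of_genusResidue`): `σ ∈ Hₙ` fixes every `7^{n+1}`-th root of unity `ζ ∈ K̄` (`e ζ ∈ μ_{7^{n+1}} ⊂ F′ₙ`), so
`χ₇(σ) ≡ 1 (mod 7^{n+1})`, so `σ ∈ Gal(K̄/Kℚ_n)` (`Kℚ_n ⊂ K(μ_{7^{n+1}})`). [cite: Washington1997, §13.1] [cite: Serre1968, Ch. I §1.2] -/
theorem layerFixing_le_layerSubgroup (K : ZpExtension ℚ 7) (hK : K.IsCyclotomic) (h2 : Module.finrank ℚ Kcm = 2)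
    (e : AlgebraicClosure Kcm →+* AlgebraicClosure ℚ) (n : ℕ) :
    layerFixing F e n ≤ (K.restrictOfFinrankEqTwo (by decide) Kcm h2).layerSubgroup n := by
  haveI : Fact (Nat.Prime 7) := ⟨Nat.prime_seven⟩
  intro σ hσ
  haveI : NeZero ((7 : ℕ) : Kcm) := ⟨by exact_mod_cast (by norm_num : (7 : ℕ) ≠ 0)⟩
  haveI : NeZero (((7 ^ (n + 1) : ℕ)) : AlgebraicClosure Kcm) := ⟨by exact_mod_cast pow_ne_zero (n + 1) (by norm_num : (7 : ℕ) ≠ 0)⟩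
  -- a primitive `7^{n+1}`-th root of unity in `K̄`, fixed by `σ`
  obtain ⟨ζ, hζ⟩ := HasEnoughRootsOfUnity.exists_primitiveRoot (AlgebraicClosure Kcm) (7 ^ (n + 1))
  have hmem : e ζ ∈ F.layer n :=
    mem_cyclotomicLayer_of_pow_eq_one F.F₀ 7 n (by rw [← map_pow, hζ.pow_eq_one, map_one])
  have hfix : σ • ζ = ζ := (F.mem_layerFixing_iff e n σ).mp hσ ζ hmem
  -- hence `χ₇(σ) ≡ 1 (mod 7^{n+1})`
  set a : ℕ := ((GaloisRep.cyclotomicCharacter Kcm 7 σ).val.toZModPow (n + 1)).val with ha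
  have hζa : ζ ^ a = ζ ^ 1 := by
    rw [pow_one, ha, ← GaloisRep.cyclotomicCharacter_spec Kcm 7 σ ζ hζ.pow_eq_one, hfix]
  rw [(hζ.isOfFinOrder (by positivity)).pow_eq_pow_iff_modEq, ← hζ.eq_orderOf] at hζa
  have h1 : (GaloisRep.cyclotomicCharacter Kcm 7 σ).val.toZModPow (n + 1) = 1 := by
    have h := (ZMod.natCast_eq_natCast_iff' a 1 (7 ^ (n + 1))).mpr hζa
    rwa [ha, ZMod.natCast_zmod_val, Nat.cast_one] at h
  have hker : ((GaloisRep.cyclotomicCharacter Kcm 7 σ : ℤ_[7]ˣ) : ℤ_[7]) - 1 ∈ RingHom.ker (PadicInt.toZModPow (n + 1)) := by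
    rw [RingHom.mem_ker, map_sub, map_one, h1, sub_self]
  rw [PadicInt.ker_toZModPow, Ideal.mem_span_singleton] at hker
  exact NumberFieldColumn.mem_layerSubgroup_restrict_of_dvd_cyclotomicCharacter_sub_one K hK (by norm_num) _ n σ hker

/-! ## §3 `hVH` (core): `Gal(K̄/K(7ⁿ·(7d))) ≤ Hₙ` -/

/-- ★ **`hVH` (core): `Gal(K̄/K(7ⁿ·(7d))) ≤ Hₙ`** (`[Kcm : ℚ] = 2`, `x² = −7`): `e⁻¹F′ₙ ⊆ K(7ⁿ·(7d))`
(`preimageField_layer_le_katoLayer_span_seven_mul`) and `Hₙ = galFixing (e⁻¹F′ₙ)`.  At the Kummer frame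
`V n = Gal(K̄/K(W₂[7ⁿ·7d])) = Gal(K̄/K(7ⁿ(7d)))` (`KummerUnitTower.V_eq_galFixing_katoLayer`) this is the binder `hVH` of
`kummerNonvanishing_of_genusResidue`. [cite: Kato2004Asterisque, 15.14 (p. 264, «F′_n ⊂ K(7^{n+1}𝔣)»)] [cite: NeukirchANT1999, Ch. VI §6 (6.7)] -/
theorem galFixing_katoLayer_span_seven_mul_le_layerFixing (h2 : Module.finrank ℚ Kcm = 2) {x : Kcm} (hx : x ^ 2 = -7)
    (e : AlgebraicClosure Kcm →+* AlgebraicClosure ℚ) (n : ℕ) :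
    galFixing Kcm (katoLayer 7 (Ideal.span {((7 * F.d : ℕ) : 𝓞 Kcm)}) n) ≤ layerFixing F e n := by
  have hK : ∀ k : Kcm, e (algebraMap Kcm (AlgebraicClosure Kcm) k) ∈ F.layer n :=
    fun k => GenusFrame.apply_algebraMap_mem_layer h2 hx e n k
  rw [layerFixing_eq_galFixing_preimageField F e n hK]
  exact galFixing_antitone Kcm (preimageField_layer_le_katoLayer_span_seven_mul F h2 hx e n hK)

end LayerGroups

/-! ## §4 The K16-gap conversion in the (C1) currency -/

section Conversion

variable {Kcm : Type} [Field Kcm] [NumberField Kcm] (h2 : Module.finrank ℚ Kcm = 2)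
  (W : WeierstrassCurve ℚ) [W.IsElliptic] [ContinuousSMul ℤ_[7] ((W.baseChange Kcm).tateModule 7)]
  (K : ZpExtension ℚ 7) {γK : absoluteGaloisGroup Kcm}
  (IK : IwasawaH1DataOver (W.baseChange Kcm) 7 (K.restrictOfFinrankEqTwo (by decide) Kcm h2) γK)
  (hγK : (K.restrictOfFinrankEqTwo (by decide) Kcm h2).IsTopGenerator γK)
  (φ : WeierstrassCurve.Isogeny (W.baseChange Kcm) (W.baseChange Kcm))
  (φ_sq : ∀ P, φ (φ P) = (-7 : ℤ) • P)

/-- ★ **THE K16-GAP CONVERSION**: if `x ∈ 𝐇¹_{K,Γ}(T₇W_K)` is NOT in the image of `φ_* = IK.isogenyMap φ` (T3a's conclusion), then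
`ιS x ∉ π·𝐇′(S′_W)`, i.e. `¬ ∃ y ∈ range toRat, mkLinearMap x = ϖ • y` — the letter of the frame field `EU_not_mem_of_residue` at the (C1)
carriers (`HS := range toRat`, `EU 𝔞 := mkLinearMap (euK 𝔞)`, `π := ϖ`): `y = ιS y₀`, `ϖ • ιS y₀ = ιS (φ_* y₀)`, `ιS` injective.
[cite: Kato2004Asterisque, 15.14 (p. 264) and (15.16.1) (p. 265)] [cite: AtiyahMacdonald1969, Ch. 3, pp. 38–39] -/
theorem not_exists_mem_range_eq_pi_smul_of_not_mem_range_isogenyMap (x : IK.H)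
    (hx : x ∉ Set.range (IK.isogenyMap φ IK hγK)) :
    letI := IK.cmModule hγK φ φ_sq
    letI := IK.cmModuleRat hγK φ φ_sq
    ¬ ∃ y ∈ LinearMap.range (IK.toRat hγK φ φ_sq),
      LocalizedModule.mkLinearMap (Submonoid.powers (7 : IwasawaAlgebra 7)) IK.H x =
        (QuadOrder.ϖ : QuadOrder (IwasawaAlgebra 7) (-7)) • y := by
  letI := IK.cmModule hγK φ φ_sq
  letI := IK.cmModuleRat hγK φ φ_sq
  rintro ⟨y, hy, hxy⟩
  obtain ⟨y₀, rfl⟩ := (CarrierAlgebra.mem_HS_iff h2 W K IK hγK φ φ_sq y).mp hy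
  rw [← CarrierAlgebra.ιS_isogenyMap h2 W K IK hγK φ φ_sq y₀] at hxy
  exact hx ⟨y₀, (CarrierAlgebra.ιS_injective h2 W K IK hxy).symm⟩

end Conversion

/-! ## §5 The ★-placement with a member type `a ∈ ℕ` (D1085 (a2)) -/

section Placement

variable {Kcm : Type} [Field Kcm] [NumberField Kcm] (h2 : Module.finrank ℚ Kcm = 2)
  (W : WeierstrassCurve ℚ) [W.IsElliptic] [ContinuousSMul ℤ_[7] (W.tateModule 7)]
  [ContinuousSMul ℤ_[7] ((W.baseChange Kcm).tateModule 7)]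
  (K : ZpExtension ℚ 7) {γ : absoluteGaloisGroup ℚ} (I : IwasawaH1Data W 7 K γ) (hγ : K.IsTopGenerator γ)
  {γK : absoluteGaloisGroup Kcm}
  (IK : IwasawaH1DataOver (W.baseChange Kcm) 7 (K.restrictOfFinrankEqTwo (by decide) Kcm h2) γK)
  (hγK : (K.restrictOfFinrankEqTwo (by decide) Kcm h2).IsTopGenerator γK)
  (φ : WeierstrassCurve.Isogeny (W.baseChange Kcm) (W.baseChange Kcm))
  (φ_sq : ∀ P, φ (φ P) = (-7 : ℤ) • P) (zOne : I.H) (k a : ℕ)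

/-- `π · (−ϖ) = 7` in `Λ_O` (`ϖ² = −7`), hence `π^a · (−ϖ)^a = 7^a`. [cite: Kato2004Asterisque, 15.14 (p. 264)] -/
theorem ϖ_pow_mul_neg_ϖ_pow (a : ℕ) :
    (QuadOrder.ϖ : QuadOrder (IwasawaAlgebra 7) (-7)) ^ a * (-QuadOrder.ϖ) ^ a = 7 ^ a := by
  rw [← mul_pow, mul_neg, ← sq, CarrierAlgebra.π_sq, neg_neg]

/-- ★ **Field `j_zOne` WITH A MEMBER TYPE `a`**: at `zS := (−ϖ)^a • (res zOne / 7^{k+a})`, `u := 1`: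
`j zOne = 7^k • (1 • π^a • zS)` in `A = 𝐇¹[1/7]` (`π^a·(−ϖ)^a = 7^a` and `7^{k+a} • (x/7^{k+a}) = ιS x`) — the letter of
`KatoGenusFrame.j_zOne` at these values, for EVERY `a : ℕ` (the constructor takes `a := memberType W ∈ {0,1}`).
[cite: Kato2004Asterisque, Thm. 12.5 (1) (p. 221), §13.9 (p. 230), §15.11 (2) (pp. 261–262)] [cite: AtiyahMacdonald1969, Ch. 3, pp. 38–39] -/
theorem j_zOne_of_memberType :
    letI := IK.cmModuleRat hγK φ φ_sq
    (LocalizedModule.mkLinearMap (Submonoid.powers (7 : IwasawaAlgebra 7)) IK.H ∘ₗ I.resOver IK hγ hγK) zOne =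
      ((7 : IwasawaAlgebra 7) ^ k) •
        ((((1 : (QuadOrder (IwasawaAlgebra 7) (-7))ˣ) : (QuadOrder (IwasawaAlgebra 7) (-7))ˣ) :
            QuadOrder (IwasawaAlgebra 7) (-7)) •
          (QuadOrder.ϖ : QuadOrder (IwasawaAlgebra 7) (-7)) ^ a •
            ((-QuadOrder.ϖ : QuadOrder (IwasawaAlgebra 7) (-7)) ^ a •
              (LocalizedModule.mk (I.resOver IK hγ hγK zOne)
                (⟨(7 : IwasawaAlgebra 7) ^ (k + a), k + a, rfl⟩ : Submonoid.powers (7 : IwasawaAlgebra 7)) : IK.ratH))) := by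
  letI := IK.cmModuleRat hγK φ φ_sq
  haveI := IK.isScalarTower_cmModuleRat hγK φ φ_sq
  rw [Units.val_one, one_smul, smul_smul, ϖ_pow_mul_neg_ϖ_pow,
    show ((7 : QuadOrder (IwasawaAlgebra 7) (-7)) ^ a) = algebraMap (IwasawaAlgebra 7) (QuadOrder (IwasawaAlgebra 7) (-7))
      ((7 : IwasawaAlgebra 7) ^ a) by rw [map_pow, map_ofNat],
    algebraMap_smul, smul_smul, ← pow_add]
  exact (CarrierAlgebra.pow_smul_mk_resOver_pow h2 W K I hγ IK hγK (k + a) zOne).symm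

/-- **Field `zeta_eq`** at `frame.zeta := zS`, `t := 1`, for the twisted `zS`: `zeta = 1 • zS`.
[cite: Kato2004Asterisque, §15.11 (15.11.3) (pp. 261–262)] -/
theorem twistedZS_eq_one_smul :
    letI := IK.cmModuleRat hγK φ φ_sq
    ((-QuadOrder.ϖ : QuadOrder (IwasawaAlgebra 7) (-7)) ^ a •
        (LocalizedModule.mk (I.resOver IK hγ hγK zOne)
          (⟨(7 : IwasawaAlgebra 7) ^ (k + a), k + a, rfl⟩ : Submonoid.powers (7 : IwasawaAlgebra 7)) : IK.ratH)) =
      (1 : QuadOrder (IwasawaAlgebra 7) (-7)) •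
        ((-QuadOrder.ϖ : QuadOrder (IwasawaAlgebra 7) (-7)) ^ a •
          (LocalizedModule.mk (I.resOver IK hγ hγK zOne)
            (⟨(7 : IwasawaAlgebra 7) ^ (k + a), k + a, rfl⟩ : Submonoid.powers (7 : IwasawaAlgebra 7)) : IK.ratH)) := by
  letI := IK.cmModuleRat hγK φ φ_sq
  exact (one_smul _ _).symm

end Placement

end Summit.BirchSwinnertonDyer.Rank1Residual.Additive.GenusSeven

end
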